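import Summits.NavierStokesRegularity.NavierStokesRegularity.Theorems.SoloRefuteSiche2026Step4Global
import HarnessLib

/-!
# C135 `Siche2026` — Theorem 7.1 (53) p. 23 is false for ONE smooth solution: `¬ Step5_shiftedCoherence`

B. Siche, «Phase Decoherence and Regularity of the Three-Dimensional Navier–Stokes Equations», Zenodo
10.5281/zenodo.19899171 v1.5 (2026). `Literature.Claims.NS.Siche2026.Step5_shiftedCoherence` (the form consumed
by `claim_of_steps`): for every smooth solution, a bound on the ORIGIN coherences `χ_K(u(t))(0) ≤ C` (all
`t ∈ (0,T)`, all `K`) yields a bound on the SHIFTED coherences `χ_K^{(x)}(u(t)) ≤ C'` uniformly in `K` AND `x`.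

WITNESS: the lacunary COSINE shear heat flow `u(t,x) = Σ_j e^{−5^j} e^{−4π²ν25^j t} cos(2π 5^j x₀) ŷ`
(`Series.lacUcos ν T`, typist-10 g3's series block; zero pressure, exact smooth solution). On the shell `25^j`
the `ŷ`-coefficients at `±5^j e₀` are REAL (`e^{−5^j}e^{−λt}/2`), so `χ_{25^j}(u(t))(0) = 0`
(`coherence_axis_zero_of_real`); every other shell is silent; hence the hypothesis holds with `C = 0`. At the
quarter-period point `x_j = (1/(4·5^j), 0, 0)` one has `e_{5^j e₀}(x_j) = i`, the phases re-align and
`χ_{25^j}(u(t))(x_j) = N_{25^j} ≥ 2(j+1)` — unbounded in `j` at the fixed time `t = 1` (ν = 1, T = 2).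

WHAT THIS IS NOT: not a claim about NS regularity or blow-up; not a claim about any author beyond the
typed locator.
-/

set_option linter.dupNamespace false

noncomputable section

open Literature.Analysis.FunctionSpaces Literature.Analysis.FunctionSpaces.Torus
open Literature.Claims.NS.Siche2026
open Set
open scoped ComplexConjugate

namespace Summit.NavierStokesRegularity.NavierStokesRegularity.Theorems.Siche2026

/-- the quarter-period point `(1/(4n), 0, 0)` of the mode `n e₀`. [folklore] -/
def xQuarter (n : ℤ) : T3 := fun i => if i = 0 then (((1 : ℝ) / (4 * n) : ℝ) : UnitAddCircle) else 0

/-- `e_{n e₀}(1/(4n), 0, 0) = e^{iπ/2} = i` (`n ≠ 0`). [folklore] -/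
theorem mFourier_kx_xQuarter {n : ℤ} (hn : n ≠ 0) :
    UnitAddTorus.mFourier (kx n) (xQuarter n) = Complex.I := by
  show ∏ i, fourier (kx n i) (xQuarter n i) = Complex.I
  have hx0 : xQuarter n 0 = (((1 : ℝ) / (4 * n) : ℝ) : UnitAddCircle) := by simp [xQuarter]
  have hx1 : xQuarter n 1 = 0 := by simp [xQuarter]
  have hx2 : xQuarter n 2 = 0 := by simp [xQuarter]
  simp only [Fin.prod_univ_three, kx_zero, kx_one, kx_two, hx0, hx1, hx2, fourier_eval_zero, mul_one]
  rw [fourier_coe_apply]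
  have hnC : (n : ℂ) ≠ 0 := by exact_mod_cast hn
  have : 2 * (Real.pi : ℂ) * Complex.I * (n : ℂ) * (((1 : ℝ) / (4 * n) : ℝ) : ℂ) / (1 : ℝ) =
      (Real.pi : ℂ) / 2 * Complex.I := by
    push_cast
    field_simp
    ring
  rw [this, Complex.exp_pi_div_two_mul_I]

/-- the (real, positive) `ŷ`-amplitude of the cosine flow on the shell `25^j` at time `t`. [folklore] -/
def ampCos (ν : ℝ) (j : ℕ) (t : ℝ) : ℝ := decay ν (Series.ax0 (5 ^ j)) t * (Real.exp (-(5 : ℝ) ^ j) / 2)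

/-- `ampCos > 0`. [folklore] -/
theorem ampCos_pos (ν : ℝ) (j : ℕ) (t : ℝ) : 0 < ampCos ν j t := by
  unfold ampCos decay; exact mul_pos (Real.exp_pos _) (by positivity)

/-- cosine flow, coefficient at `+5^j e₀`: `(0, a, 0)` with `a = ampCos` real. [folklore] -/
theorem coeff_lacUcos_pos {ν T t : ℝ} (hν : 0 < ν) (hT : 0 < T) (ht : t ∈ Icc 0 T) (j : ℕ) :
    coeff (Series.lacUcos ν T t) (kx ((5 : ℤ) ^ j)) = yC ((ampCos ν j t : ℝ) : ℂ) := by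
  unfold coeff
  rw [← ax0_eq_kx, Series.coeff_lacUcos hν hT ht, Series.lacCoeffCos, (Series.lacScalarCos_ax0_pow j).1,
    smul_smul, smul_e1C_eq_yC]
  congr 1
  unfold ampCos decay; push_cast; ring

/-- cosine flow, coefficient at `−5^j e₀`: `(0, ā, 0) = (0, a, 0)`. [folklore] -/
theorem coeff_lacUcos_neg {ν T t : ℝ} (hν : 0 < ν) (hT : 0 < T) (ht : t ∈ Icc 0 T) (j : ℕ) :
    coeff (Series.lacUcos ν T t) (-kx ((5 : ℤ) ^ j)) = yC (conj ((ampCos ν j t : ℝ) : ℂ)) := by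
  unfold coeff
  rw [neg_kx, ← ax0_eq_kx, Series.coeff_lacUcos hν hT ht, Series.lacCoeffCos,
    (Series.lacScalarCos_ax0_pow j).2, smul_smul, smul_e1C_eq_yC, Complex.conj_ofReal]
  congr 1
  have hd : decay ν (Series.ax0 (-(5 ^ j))) t = decay ν (Series.ax0 (5 ^ j)) t := decay_neg ν _ t
  unfold ampCos; rw [← hd]; unfold decay; push_cast; ring

/-- cosine flow: the rest of the shell `25^j` is silent. [folklore] -/
theorem coeff_lacUcos_shell_off {ν T t : ℝ} (hν : 0 < ν) (hT : 0 < T) (ht : t ∈ Icc 0 T) (j : ℕ) :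
    ∀ k ∈ shell (25 ^ j), k ≠ kx ((5 : ℤ) ^ j) → k ≠ -kx ((5 : ℤ) ^ j) →
      coeff (Series.lacUcos ν T t) k = 0 := by
  intro k hk h1 h2
  unfold coeff
  rw [Series.coeff_lacUcos hν hT ht, Series.lacCoeffCos_off (not_mem_lacSupp_of_mem_shell hk h1 h2),
    smul_zero]

/-- **cosine flow: zero ORIGIN coherence on its active shells**, `χ_{25^j}(u(t))(0) = 0`.
[cite: Siche2026, Definition 4.1 p. 7; Theorem 7.1 (53) p. 23] -/
theorem coherence_lacUcos_shell_zero {ν T t : ℝ} (hν : 0 < ν) (hT : 0 < T) (ht : t ∈ Icc 0 T) (j : ℕ) :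
    coherence (Series.lacUcos ν T t) (25 ^ j) 0 = 0 :=
  coherence_axis_zero_of_real (by positivity) (kx_five_pow_mem_shell j) (ampCos_pos ν j t).ne'
    (coeff_lacUcos_pos hν hT ht j) (coeff_lacUcos_neg hν hT ht j) (coeff_lacUcos_shell_off hν hT ht j)

/-- a shell meeting the lacunary support is one of the shells `25^j`. [folklore] -/
theorem eq_pow_of_mem_shell_of_mem_lacSupp {K : ℕ} {k : Z3} (hk : k ∈ shell K) (hs : k ∈ Series.lacSupp) :
    ∃ j : ℕ, K = 25 ^ j := by
  obtain ⟨j, hj⟩ := Series.mem_lacSupp_iff.1 hs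
  refine ⟨j, ?_⟩
  have hK := mem_shell.1 hk
  unfold latticeNormSq at hK
  have h25 : (K : ℤ) = 25 ^ j := by
    rw [← hK]
    rcases hj with rfl | rfl <;> rw [Series.sum_sq_ax0] <;> [skip; rw [neg_sq]] <;>
      rw [← pow_mul, mul_comm, pow_mul] <;> norm_num
  exact_mod_cast h25

/-- **cosine flow: the ORIGIN coherence vanishes on EVERY shell** (active shells by the real phases, the
others by silence). [cite: Siche2026, Theorem 7.1 (53) p. 23] -/
theorem coherence_lacUcos_zero {ν T t : ℝ} (hν : 0 < ν) (hT : 0 < T) (ht : t ∈ Icc 0 T) (K : ℕ) :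
    coherence (Series.lacUcos ν T t) K 0 = 0 := by
  by_cases h : ∃ k ∈ shell K, k ∈ Series.lacSupp
  · obtain ⟨k, hk, hs⟩ := h
    obtain ⟨j, rfl⟩ := eq_pow_of_mem_shell_of_mem_lacSupp hk hs
    exact coherence_lacUcos_shell_zero hν hT ht j
  · refine coherence_eq_zero_of_silent (fun k hk => ?_) 0
    unfold coeff
    rw [Series.coeff_lacUcos hν hT ht, Series.lacCoeffCos_off (fun hs => h ⟨k, hk, hs⟩), smul_zero]

/-- **cosine flow: FULL coherence at the quarter-period shift**, `χ_{25^j}(u(t))(1/(4·5^j), 0, 0) = N_{25^j}`.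
[cite: Siche2026, Theorem 7.1 (53) p. 23] -/
theorem coherence_lacUcos_xQuarter {ν T t : ℝ} (hν : 0 < ν) (hT : 0 < T) (ht : t ∈ Icc 0 T) (j : ℕ) :
    coherence (Series.lacUcos ν T t) (25 ^ j) (xQuarter ((5 : ℤ) ^ j)) = shellModes (25 ^ j) := by
  have hn : (0 : ℤ) < 5 ^ j := by positivity
  have ha := ampCos_pos ν j t
  have hβ : ((ampCos ν j t : ℝ) : ℂ) ≠ 0 := by exact_mod_cast ha.ne'
  rw [coherence_axis hn (kx_five_pow_mem_shell j) hβ (coeff_lacUcos_pos hν hT ht j)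
    (coeff_lacUcos_neg hν hT ht j) (coeff_lacUcos_shell_off hν hT ht j), mFourier_kx_xQuarter hn.ne']
  have h1 : (Complex.I * ((ampCos ν j t : ℝ) : ℂ)).im = ampCos ν j t := by simp
  have h2 : ‖((ampCos ν j t : ℝ) : ℂ)‖ = ampCos ν j t := by
    rw [Complex.norm_real, Real.norm_of_nonneg ha.le]
  rw [h1, h2, div_self (pow_ne_zero 2 ha.ne'), mul_one]

/-- **Refutation of Step 5 in its per-solution form** (`Literature.Claims.NS.Siche2026.Step5_shiftedCoherence`,
Theorem 7.1 (53) p. 23, «for u₀ ∈ H¹ the shifted coherence satisfies χ_K^{(x₀)}(t) ≤ C' uniformly in K and x₀»):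
the cosine lacunary shear flow `Series.lacUcos 1 2` has ALL origin coherences equal to `0` (hypothesis with
`C = 0`) while `χ_{25^j}(u(1))(1/(4·5^j),0,0) = N_{25^j}` is unbounded in `j`.
[cite: Siche2026, Theorem 7.1 (53) p. 23; Definition 4.1 p. 7] -/
theorem not_Step5_shiftedCoherence : ¬ Step5_shiftedCoherence := by
  intro h
  obtain ⟨C', hC'⟩ := h 1 one_pos 2 (Series.lacUcos 1 2) (fun _ _ => 0)
    (Series.isClassicalNSSolutionOn_lacUcos one_pos two_pos)
    ⟨0, fun t ht K => (coherence_lacUcos_zero one_pos two_pos ⟨ht.1.le, ht.2.le⟩ K).le⟩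
  obtain ⟨j, -, hj⟩ := exists_shell_card_gt C'
  have h1 := hC' 1 ⟨one_pos, one_lt_two⟩ (25 ^ j) (xQuarter ((5 : ℤ) ^ j))
  rw [coherence_lacUcos_xQuarter one_pos two_pos ⟨zero_le_one, one_le_two⟩ j] at h1
  unfold shellModes at h1
  push_cast at h1
  linarith

end Summit.NavierStokesRegularity.NavierStokesRegularity.Theorems.Siche2026
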